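import Summits.MatrixMultiplication.OmegaCensus.DominoZpZpStructSixCore
import Summits.MatrixMultiplication.OmegaCensus.DominoZpZpStructFiveCheck
import HarnessLib

/-!
# Structural cover argument for part size `6`: the finite PAIR CHECKS and their soundness

ω-census `pub-omega`, family (b3), seat pub-omega-group gen 23.  Framing: lottery ticket; floor = certified bounds/negative
ranges.  VALUE: reduces the pair properties `h3a` (three equal values `x₀ = x₁ = x₂` against `y₀ = y₃`) and `h3b` (`x₀ = x₁`,
`x₂ = x₃` against `y₀ = y₂`) of `DominoZpZpStructSixCore.exists_goodS` to Bool programs over scaling representatives `R` of the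
excluded list `E`, a key tree `et` of the codes `polyBE 7` of `E` (whose COMPLETENESS `hEt` is itself a cheap decide), and
precomputed `y`-arrangement lists `YSa`, `YSb` (whose completeness `hYSa`, `hYSb` is decided per representative); pattern of
`DominoZpZpStructFiveCheck.lean` (`mVal` is reused); NOT progress on ω.
-/

namespace Summit.MatrixMultiplication.OmegaCensus

open Finset

namespace ZpZpDomino

/-! ## Programs -/

section Program

/-- The fifteen index pairs `i < j` of `Fin 6`. [folklore] -/
def pairs15 : List (ℕ × ℕ) :=
  [(0,1), (0,2), (0,3), (0,4), (0,5), (1,2), (1,3), (1,4), (1,5), (2,3), (2,4), (2,5), (3,4), (3,5), (4,5)]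

/-- The pairs are valid distinct indices. [folklore] -/
theorem pairs15_spec : ∀ ij ∈ pairs15, ij.1 < 6 ∧ ij.2 < 6 ∧ ij.1 ≠ ij.2 := by decide

/-- Some index pair separates the points and collapses to a sextuple whose count-vector code is not in the tree `et`. [folklore] -/
def pairGood6 (p : ℕ) (et : BTree) (xs ys : List ℕ) : Bool :=
  pairs15.any fun ij =>
    (!(xs.getD ij.1 0 == xs.getD ij.2 0) || !(ys.getD ij.1 0 == ys.getD ij.2 0)) &&
      !(et.mem (hornerS 7 (cv6 p (mVal p xs ys ij.1 ij.2 0) (mVal p xs ys ij.1 ij.2 1) (mVal p xs ys ij.1 ij.2 2)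
        (mVal p xs ys ij.1 ij.2 3) (mVal p xs ys ij.1 ij.2 4) (mVal p xs ys ij.1 ij.2 5)) 0))

/-- Arrangements `[a,a,a,b,c,d]` (values in the support of `k`, count vector `k`). [folklore] -/
def arr6T (p : ℕ) (k : List ℕ) : List (List ℕ) :=
  (List.range p).flatMap fun a => if k.getD a 0 == 0 then [] else
    (List.range p).flatMap fun b => if k.getD b 0 == 0 then [] else
      (List.range p).flatMap fun c => if k.getD c 0 == 0 then [] else
        (List.range p).flatMap fun d => if k.getD d 0 == 0 then [] else
          if cv6 p a a a b c d == k then [[a, a, a, b, c, d]] else []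

/-- Arrangements `[a,b,c,a,d,e]` (`y₀ = y₃`). [folklore] -/
def arr6Y3 (p : ℕ) (k : List ℕ) : List (List ℕ) :=
  (List.range p).flatMap fun a => if k.getD a 0 == 0 then [] else
    (List.range p).flatMap fun b => if k.getD b 0 == 0 then [] else
      (List.range p).flatMap fun c => if k.getD c 0 == 0 then [] else
        (List.range p).flatMap fun d => if k.getD d 0 == 0 then [] else
          (List.range p).flatMap fun e => if k.getD e 0 == 0 then [] else
            if cv6 p a b c a d e == k then [[a, b, c, a, d, e]] else []

/-- Arrangements `[a,a,b,b,c,d]` (`x₀ = x₁`, `x₂ = x₃`). [folklore] -/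
def arr6P (p : ℕ) (k : List ℕ) : List (List ℕ) :=
  (List.range p).flatMap fun a => if k.getD a 0 == 0 then [] else
    (List.range p).flatMap fun b => if k.getD b 0 == 0 then [] else
      (List.range p).flatMap fun c => if k.getD c 0 == 0 then [] else
        (List.range p).flatMap fun d => if k.getD d 0 == 0 then [] else
          if cv6 p a a b b c d == k then [[a, a, b, b, c, d]] else []

/-- Arrangements `[a,b,a,c,d,e]` (`y₀ = y₂`). [folklore] -/
def arr6Y2 (p : ℕ) (k : List ℕ) : List (List ℕ) :=
  (List.range p).flatMap fun a => if k.getD a 0 == 0 then [] else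
    (List.range p).flatMap fun b => if k.getD b 0 == 0 then [] else
      (List.range p).flatMap fun c => if k.getD c 0 == 0 then [] else
        (List.range p).flatMap fun d => if k.getD d 0 == 0 then [] else
          (List.range p).flatMap fun e => if k.getD e 0 == 0 then [] else
            if cv6 p a b a c d e == k then [[a, b, a, c, d, e]] else []

/-- The pair check for ONE `x`-arrangement against the `y`-arrangement list `YS` (the unit the per-prime files decide).
[folklore] -/
def checkH6x (p : ℕ) (et : BTree) (YS : List (List ℕ)) (xs : List ℕ) : Bool := YS.all fun ys => pairGood6 p et xs ys

/-- The pair check of family `a` for one representative `k₁` against the `y`-arrangement list `YS`. [folklore] -/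
def checkH6a (p : ℕ) (et : BTree) (YS : List (List ℕ)) (k₁ : List ℕ) : Bool :=
  (arr6T p k₁).all fun xs => YS.all fun ys => pairGood6 p et xs ys

/-- The pair check of family `b` for one representative `k₁`. [folklore] -/
def checkH6b (p : ℕ) (et : BTree) (YS : List (List ℕ)) (k₁ : List ℕ) : Bool :=
  (arr6P p k₁).all fun xs => YS.all fun ys => pairGood6 p et xs ys

/-- Every excluded key scales into the list of representatives (part `6` copy of `checkR`). [folklore] -/
def checkR6 (p : ℕ) (E R : List (List ℕ)) : Bool :=
  E.all fun k => (List.range p).any fun κ => !(κ == 0) && R.contains (scaleVec p κ k)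

/-- Family `a` from its `x`-arrangements. [folklore] -/
theorem checkH6a_of_x {p : ℕ} {et : BTree} {YS : List (List ℕ)} {k : List ℕ}
    (h : ∀ xs ∈ arr6T p k, checkH6x p et YS xs = true) : checkH6a p et YS k = true := by
  rw [checkH6a, List.all_eq_true]; exact h

/-- Family `b` from its `x`-arrangements. [folklore] -/
theorem checkH6b_of_x {p : ℕ} {et : BTree} {YS : List (List ℕ)} {k : List ℕ}
    (h : ∀ xs ∈ arr6P p k, checkH6x p et YS xs = true) : checkH6b p et YS k = true := by
  rw [checkH6b, List.all_eq_true]; exact h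

end Program

/-! ## Soundness -/

section Sound

variable {p : ℕ} [Fact p.Prime]

/-- The list of values of a sextuple. [folklore] -/
def vals6 (a : Fin 6 → ZMod p) : List ℕ := [(a 0).val, (a 1).val, (a 2).val, (a 3).val, (a 4).val, (a 5).val]

omit [Fact p.Prime] in
/-- Entries of `vals6`. [folklore] -/
theorem getD_vals6 (a : Fin 6 → ZMod p) (k : Fin 6) : (vals6 a).getD k.val 0 = (a k).val := by
  fin_cases k <;> rfl

/-- `mVal` on `vals6` computes `(yᵢ − yⱼ)·xₖ − (xᵢ − xⱼ)·yₖ`. [folklore] -/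
theorem natCast_mVal6 (x y : Fin 6 → ZMod p) (i j k : Fin 6) :
    ((mVal p (vals6 x) (vals6 y) i.val j.val k.val : ℕ) : ZMod p) = (y i - y j) * x k - (x i - x j) * y k := by
  unfold mVal
  rw [getD_vals6, getD_vals6, getD_vals6, getD_vals6, getD_vals6, getD_vals6, ZMod.natCast_mod]
  push_cast
  rw [Nat.cast_sub (ZMod.val_le _), Nat.cast_sub (ZMod.val_le _)]
  simp only [ZMod.natCast_val, ZMod.cast_id', id_eq, ZMod.natCast_self]
  ring

/-- The value of the collapsing sextuple equals `mVal`. [folklore] -/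
theorem val_m_eq_mVal6 (x y : Fin 6 → ZMod p) (i j k : Fin 6) :
    ((y i - y j) * x k - (x i - x j) * y k).val = mVal p (vals6 x) (vals6 y) i.val j.val k.val := by
  rw [← natCast_mVal6, ZMod.val_natCast, Nat.mod_eq_of_lt (mVal_lt (Fact.out : p.Prime).pos _ _ _ _ _)]

/-- **Soundness of `pairGood6`**: with a COMPLETE code tree of `E` (`hEt`), a good pair has distinct points and a key outside `E`.
[folklore] -/
theorem exists_pair_of_pairGood6 {E : List (List ℕ)} {et : BTree} (hEt : ∀ k ∈ E, et.mem (polyBE 7 k) = true)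
    (x y : Fin 6 → ZMod p) (h : pairGood6 p et (vals6 x) (vals6 y) = true) :
    ∃ i j : Fin 6, (x i, y i) ≠ (x j, y j) ∧ key6 (fun k => (y i - y j) * x k - (x i - x j) * y k) ∉ E := by
  rw [pairGood6, List.any_eq_true] at h
  obtain ⟨ij, hij, hgood⟩ := h
  obtain ⟨hi, hj, -⟩ := pairs15_spec ij hij
  rw [Bool.and_eq_true] at hgood
  obtain ⟨hsep, hnot⟩ := hgood
  refine ⟨⟨ij.1, hi⟩, ⟨ij.2, hj⟩, fun e => ?_, fun hmem => ?_⟩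
  · rw [Bool.or_eq_true, Bool.not_eq_true', Bool.not_eq_true', beq_eq_false_iff_ne, beq_eq_false_iff_ne,
      getD_vals6 x ⟨ij.1, hi⟩, getD_vals6 x ⟨ij.2, hj⟩, getD_vals6 y ⟨ij.1, hi⟩, getD_vals6 y ⟨ij.2, hj⟩] at hsep
    have e1 := congrArg Prod.fst e
    have e2 := congrArg Prod.snd e
    simp only at e1 e2
    rcases hsep with h1 | h1
    · exact h1 (by rw [e1])
    · exact h1 (by rw [e2])
  · rw [Bool.not_eq_true', hornerS_zero] at hnot
    have hkey : key6 (fun k => (y ⟨ij.1, hi⟩ - y ⟨ij.2, hj⟩) * x k - (x ⟨ij.1, hi⟩ - x ⟨ij.2, hj⟩) * y k) =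
        cv6 p (mVal p (vals6 x) (vals6 y) ij.1 ij.2 0) (mVal p (vals6 x) (vals6 y) ij.1 ij.2 1)
          (mVal p (vals6 x) (vals6 y) ij.1 ij.2 2) (mVal p (vals6 x) (vals6 y) ij.1 ij.2 3)
          (mVal p (vals6 x) (vals6 y) ij.1 ij.2 4) (mVal p (vals6 x) (vals6 y) ij.1 ij.2 5) := by
      unfold key6
      rw [val_m_eq_mVal6 x y ⟨ij.1, hi⟩ ⟨ij.2, hj⟩ 0, val_m_eq_mVal6 x y ⟨ij.1, hi⟩ ⟨ij.2, hj⟩ 1,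
        val_m_eq_mVal6 x y ⟨ij.1, hi⟩ ⟨ij.2, hj⟩ 2, val_m_eq_mVal6 x y ⟨ij.1, hi⟩ ⟨ij.2, hj⟩ 3,
        val_m_eq_mVal6 x y ⟨ij.1, hi⟩ ⟨ij.2, hj⟩ 4, val_m_eq_mVal6 x y ⟨ij.1, hi⟩ ⟨ij.2, hj⟩ 5]
      rfl
    have := hEt _ hmem
    rw [hkey] at this
    rw [this] at hnot
    exact Bool.noConfusion hnot

/-- `vals6 x ∈ arr6T p k` for `x 0 = x 1 = x 2`, `key6 x = k`. [folklore] -/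
theorem vals_mem_arr6T (x : Fin 6 → ZMod p) (h01 : x 0 = x 1) (h12 : x 1 = x 2) {k : List ℕ} (hk : key6 x = k) :
    vals6 x ∈ arr6T p k := by
  have g0 := one_le_getD_key6 x 0
  have g3 := one_le_getD_key6 x 3
  have g4 := one_le_getD_key6 x 4
  have g5 := one_le_getD_key6 x 5
  rw [hk] at g0 g3 g4 g5
  have hcv : (cv6 p (x 0).val (x 0).val (x 0).val (x 3).val (x 4).val (x 5).val == k) = true := by
    rw [beq_iff_eq, ← hk, key6, ← h12, ← h01]
  have e : vals6 x = [(x 0).val, (x 0).val, (x 0).val, (x 3).val, (x 4).val, (x 5).val] := by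
    rw [vals6, ← h12, ← h01]
  rw [e, arr6T, List.mem_flatMap]
  refine ⟨(x 0).val, List.mem_range.2 (ZMod.val_lt _), ?_⟩
  rw [if_neg (by rw [beq_iff_eq]; omega), List.mem_flatMap]
  refine ⟨(x 3).val, List.mem_range.2 (ZMod.val_lt _), ?_⟩
  rw [if_neg (by rw [beq_iff_eq]; omega), List.mem_flatMap]
  refine ⟨(x 4).val, List.mem_range.2 (ZMod.val_lt _), ?_⟩
  rw [if_neg (by rw [beq_iff_eq]; omega), List.mem_flatMap]
  refine ⟨(x 5).val, List.mem_range.2 (ZMod.val_lt _), ?_⟩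
  rw [if_neg (by rw [beq_iff_eq]; omega), if_pos hcv]
  exact List.mem_singleton.2 rfl

/-- `vals6 y ∈ arr6Y3 p k` for `y 0 = y 3`, `key6 y = k`. [folklore] -/
theorem vals_mem_arr6Y3 (y : Fin 6 → ZMod p) (h03 : y 0 = y 3) {k : List ℕ} (hk : key6 y = k) :
    vals6 y ∈ arr6Y3 p k := by
  have g0 := one_le_getD_key6 y 0
  have g1 := one_le_getD_key6 y 1
  have g2 := one_le_getD_key6 y 2
  have g4 := one_le_getD_key6 y 4
  have g5 := one_le_getD_key6 y 5
  rw [hk] at g0 g1 g2 g4 g5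
  have hcv : (cv6 p (y 0).val (y 1).val (y 2).val (y 0).val (y 4).val (y 5).val == k) = true := by
    rw [beq_iff_eq, ← hk, key6, ← h03]
  have e : vals6 y = [(y 0).val, (y 1).val, (y 2).val, (y 0).val, (y 4).val, (y 5).val] := by rw [vals6, ← h03]
  rw [e, arr6Y3, List.mem_flatMap]
  refine ⟨(y 0).val, List.mem_range.2 (ZMod.val_lt _), ?_⟩
  rw [if_neg (by rw [beq_iff_eq]; omega), List.mem_flatMap]
  refine ⟨(y 1).val, List.mem_range.2 (ZMod.val_lt _), ?_⟩
  rw [if_neg (by rw [beq_iff_eq]; omega), List.mem_flatMap]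
  refine ⟨(y 2).val, List.mem_range.2 (ZMod.val_lt _), ?_⟩
  rw [if_neg (by rw [beq_iff_eq]; omega), List.mem_flatMap]
  refine ⟨(y 4).val, List.mem_range.2 (ZMod.val_lt _), ?_⟩
  rw [if_neg (by rw [beq_iff_eq]; omega), List.mem_flatMap]
  refine ⟨(y 5).val, List.mem_range.2 (ZMod.val_lt _), ?_⟩
  rw [if_neg (by rw [beq_iff_eq]; omega), if_pos hcv]
  exact List.mem_singleton.2 rfl

/-- `vals6 x ∈ arr6P p k` for `x 0 = x 1`, `x 2 = x 3`, `key6 x = k`. [folklore] -/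
theorem vals_mem_arr6P (x : Fin 6 → ZMod p) (h01 : x 0 = x 1) (h23 : x 2 = x 3) {k : List ℕ} (hk : key6 x = k) :
    vals6 x ∈ arr6P p k := by
  have g0 := one_le_getD_key6 x 0
  have g2 := one_le_getD_key6 x 2
  have g4 := one_le_getD_key6 x 4
  have g5 := one_le_getD_key6 x 5
  rw [hk] at g0 g2 g4 g5
  have hcv : (cv6 p (x 0).val (x 0).val (x 2).val (x 2).val (x 4).val (x 5).val == k) = true := by
    rw [beq_iff_eq, ← hk, key6, ← h23, ← h01]
  have e : vals6 x = [(x 0).val, (x 0).val, (x 2).val, (x 2).val, (x 4).val, (x 5).val] := by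
    rw [vals6, ← h23, ← h01]
  rw [e, arr6P, List.mem_flatMap]
  refine ⟨(x 0).val, List.mem_range.2 (ZMod.val_lt _), ?_⟩
  rw [if_neg (by rw [beq_iff_eq]; omega), List.mem_flatMap]
  refine ⟨(x 2).val, List.mem_range.2 (ZMod.val_lt _), ?_⟩
  rw [if_neg (by rw [beq_iff_eq]; omega), List.mem_flatMap]
  refine ⟨(x 4).val, List.mem_range.2 (ZMod.val_lt _), ?_⟩
  rw [if_neg (by rw [beq_iff_eq]; omega), List.mem_flatMap]
  refine ⟨(x 5).val, List.mem_range.2 (ZMod.val_lt _), ?_⟩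
  rw [if_neg (by rw [beq_iff_eq]; omega), if_pos hcv]
  exact List.mem_singleton.2 rfl

/-- `vals6 y ∈ arr6Y2 p k` for `y 0 = y 2`, `key6 y = k`. [folklore] -/
theorem vals_mem_arr6Y2 (y : Fin 6 → ZMod p) (h02 : y 0 = y 2) {k : List ℕ} (hk : key6 y = k) :
    vals6 y ∈ arr6Y2 p k := by
  have g0 := one_le_getD_key6 y 0
  have g1 := one_le_getD_key6 y 1
  have g3 := one_le_getD_key6 y 3
  have g4 := one_le_getD_key6 y 4
  have g5 := one_le_getD_key6 y 5
  rw [hk] at g0 g1 g3 g4 g5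
  have hcv : (cv6 p (y 0).val (y 1).val (y 0).val (y 3).val (y 4).val (y 5).val == k) = true := by
    rw [beq_iff_eq, ← hk, key6, ← h02]
  have e : vals6 y = [(y 0).val, (y 1).val, (y 0).val, (y 3).val, (y 4).val, (y 5).val] := by rw [vals6, ← h02]
  rw [e, arr6Y2, List.mem_flatMap]
  refine ⟨(y 0).val, List.mem_range.2 (ZMod.val_lt _), ?_⟩
  rw [if_neg (by rw [beq_iff_eq]; omega), List.mem_flatMap]
  refine ⟨(y 1).val, List.mem_range.2 (ZMod.val_lt _), ?_⟩
  rw [if_neg (by rw [beq_iff_eq]; omega), List.mem_flatMap]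
  refine ⟨(y 3).val, List.mem_range.2 (ZMod.val_lt _), ?_⟩
  rw [if_neg (by rw [beq_iff_eq]; omega), List.mem_flatMap]
  refine ⟨(y 4).val, List.mem_range.2 (ZMod.val_lt _), ?_⟩
  rw [if_neg (by rw [beq_iff_eq]; omega), List.mem_flatMap]
  refine ⟨(y 5).val, List.mem_range.2 (ZMod.val_lt _), ?_⟩
  rw [if_neg (by rw [beq_iff_eq]; omega), if_pos hcv]
  exact List.mem_singleton.2 rfl

omit [Fact p.Prime] in
/-- `checkR6` ⇒ every excluded key scales into `R`. [folklore] -/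
theorem hR6_of_check {E R : List (List ℕ)} (h : checkR6 p E R = true) :
    ∀ k ∈ E, ∃ κ : ℕ, 1 ≤ κ ∧ κ < p ∧ scaleVec p κ k ∈ R := by
  intro k hk
  simp only [checkR6, List.all_eq_true, List.any_eq_true, List.mem_range, Bool.and_eq_true, Bool.not_eq_true',
    beq_eq_false_iff_ne, ne_eq, List.contains_iff_mem] at h
  obtain ⟨κ, hκ, h0, hR⟩ := h k hk
  exact ⟨κ, Nat.one_le_iff_ne_zero.2 h0, hκ, hR⟩

/-- Scaling a sextuple into the representatives. [folklore] -/
theorem exists_smul_mem_R6 {E R : List (List ℕ)} (hR : ∀ k ∈ E, ∃ κ : ℕ, 1 ≤ κ ∧ κ < p ∧ scaleVec p κ k ∈ R)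
    (x : Fin 6 → ZMod p) (hx : key6 x ∈ E) : ∃ κ : ZMod p, κ ≠ 0 ∧ key6 (fun i => κ * x i) ∈ R := by
  obtain ⟨κ, hκ1, hκp, hκR⟩ := hR _ hx
  have hκ : ((κ : ℕ) : ZMod p) ≠ 0 := by
    rw [Ne, ZMod.natCast_eq_zero_iff]; exact Nat.not_dvd_of_pos_of_lt hκ1 hκp
  refine ⟨κ, hκ, ?_⟩
  have := key6_smul hκ x
  rw [ZMod.val_natCast, Nat.mod_eq_of_lt hκp] at this
  rw [this]; exact hκR

/-- Unscaling the conclusion of a pair check. [folklore] -/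
theorem unscale_pair6 {E : List (List ℕ)} (hE2 : ∀ k ∈ E, ∀ κ : ℕ, 1 ≤ κ → κ < p → scaleVec p κ k ∈ E)
    (x y : Fin 6 → ZMod p) {κ μ : ZMod p} (hκ : κ ≠ 0) (hμ : μ ≠ 0) {i j : Fin 6}
    (hne : (κ * x i, μ * y i) ≠ (κ * x j, μ * y j))
    (hm : key6 (fun k => (μ * y i - μ * y j) * (κ * x k) - (κ * x i - κ * x j) * (μ * y k)) ∉ E) :
    (x i, y i) ≠ (x j, y j) ∧ key6 (fun k => (y i - y j) * x k - (x i - x j) * y k) ∉ E := by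
  refine ⟨fun e => hne ?_, fun hmem => hm ?_⟩
  · have e1 := congrArg Prod.fst e
    have e2 := congrArg Prod.snd e
    simp only at e1 e2
    rw [e1, e2]
  · have hsc : (fun k => (μ * y i - μ * y j) * (κ * x k) - (κ * x i - κ * x j) * (μ * y k)) =
        fun k => (κ * μ) * ((y i - y j) * x k - (x i - x j) * y k) := by funext k; ring
    rw [hsc]
    exact key6_smul_mem hE2 (mul_ne_zero hκ hμ) _ hmem

/-- **Soundness of the family-`a` check** (hypothesis `h3a` of `exists_goodS`). [folklore] -/
theorem h3a_of_checkH6a {E R : List (List ℕ)} {et : BTree} {YS : List (List ℕ)}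
    (hE2 : ∀ k ∈ E, ∀ κ : ℕ, 1 ≤ κ → κ < p → scaleVec p κ k ∈ E)
    (hR : ∀ k ∈ E, ∃ κ : ℕ, 1 ≤ κ ∧ κ < p ∧ scaleVec p κ k ∈ R) (hEt : ∀ k ∈ E, et.mem (polyBE 7 k) = true)
    (hYS : ∀ k ∈ R, ∀ ys ∈ arr6Y3 p k, ys ∈ YS) (hchk : ∀ k ∈ R, checkH6a p et YS k = true)
    (x y : Fin 6 → ZMod p) (h01 : x 0 = x 1) (h12 : x 1 = x 2) (hxE : key6 x ∈ E) (h03 : y 0 = y 3)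
    (hyE : key6 y ∈ E) :
    ∃ i j : Fin 6, (x i, y i) ≠ (x j, y j) ∧ key6 (fun k => (y i - y j) * x k - (x i - x j) * y k) ∉ E := by
  obtain ⟨κ, hκ, hxR⟩ := exists_smul_mem_R6 hR x hxE
  obtain ⟨μ, hμ, hyR⟩ := exists_smul_mem_R6 hR y hyE
  set x' : Fin 6 → ZMod p := fun i => κ * x i with hx'
  set y' : Fin 6 → ZMod p := fun i => μ * y i with hy'
  have h1 := hchk _ hxR
  rw [checkH6a, List.all_eq_true] at h1
  have h2 := h1 _ (vals_mem_arr6T x' (by simp only [hx', h01]) (by simp only [hx', h12]) rfl)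
  rw [List.all_eq_true] at h2
  have hpg := h2 _ (hYS _ hyR _ (vals_mem_arr6Y3 y' (by simp only [hy', h03]) rfl))
  obtain ⟨i, j, hne, hm⟩ := exists_pair_of_pairGood6 hEt x' y' hpg
  exact ⟨i, j, unscale_pair6 hE2 x y hκ hμ hne hm⟩

/-- **Soundness of the family-`b` check** (hypothesis `h3b` of `exists_goodS`). [folklore] -/
theorem h3b_of_checkH6b {E R : List (List ℕ)} {et : BTree} {YS : List (List ℕ)}
    (hE2 : ∀ k ∈ E, ∀ κ : ℕ, 1 ≤ κ → κ < p → scaleVec p κ k ∈ E)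
    (hR : ∀ k ∈ E, ∃ κ : ℕ, 1 ≤ κ ∧ κ < p ∧ scaleVec p κ k ∈ R) (hEt : ∀ k ∈ E, et.mem (polyBE 7 k) = true)
    (hYS : ∀ k ∈ R, ∀ ys ∈ arr6Y2 p k, ys ∈ YS) (hchk : ∀ k ∈ R, checkH6b p et YS k = true)
    (x y : Fin 6 → ZMod p) (h01 : x 0 = x 1) (h23 : x 2 = x 3) (hxE : key6 x ∈ E) (h02 : y 0 = y 2)
    (hyE : key6 y ∈ E) :
    ∃ i j : Fin 6, (x i, y i) ≠ (x j, y j) ∧ key6 (fun k => (y i - y j) * x k - (x i - x j) * y k) ∉ E := by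
  obtain ⟨κ, hκ, hxR⟩ := exists_smul_mem_R6 hR x hxE
  obtain ⟨μ, hμ, hyR⟩ := exists_smul_mem_R6 hR y hyE
  set x' : Fin 6 → ZMod p := fun i => κ * x i with hx'
  set y' : Fin 6 → ZMod p := fun i => μ * y i with hy'
  have h1 := hchk _ hxR
  rw [checkH6b, List.all_eq_true] at h1
  have h2 := h1 _ (vals_mem_arr6P x' (by simp only [hx', h01]) (by simp only [hx', h23]) rfl)
  rw [List.all_eq_true] at h2
  have hpg := h2 _ (hYS _ hyR _ (vals_mem_arr6Y2 y' (by simp only [hy', h02]) rfl))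
  obtain ⟨i, j, hne, hm⟩ := exists_pair_of_pairGood6 hEt x' y' hpg
  exact ⟨i, j, unscale_pair6 hE2 x y hκ hμ hne hm⟩

end Sound

end ZpZpDomino

end Summit.MatrixMultiplication.OmegaCensus
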